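import Summits.AtomisticToContinuum.FouriersLaw.Theorems.BondHeatUncertaintyExtensiveSnapshotIrreversibilityOddLogDensityOfRegularityAux1
import HarnessLib

/-!
# Crux `ExtensiveSnapshotIrreversibility` (stmt-AtomisticToContinuum-9121), line `clausius-budget-sound-window`:
stub S1g `stub_oddLogDensity_of_regularity`

Registered stub of the lead's checked skeleton (v6) of the line, proved verbatim (name + signature) so that
`ledger propose --supports stmt-AtomisticToContinuum-9121` accepts it.

Content (fixed `N ≥ 2`, soft analysis). For the pinned anharmonic chain `P = pinnedChain ω₂ lam β γ`
with both baths near `T > 0`, let `μ_δ = μ_{N,T+δ/2,T−δ/2}` be the steady-state family and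
`μ_T = P.gibbsMeasure N T` the Gibbs state (`= μ_{N,T,T}` under weak-NESS uniqueness). The REGULARITY
statement (R) of the NESS log-density — `μ_δ = μ_T · e^{φ_δ}` for small `δ ≠ 0` with
(R2) `|φ_δ| ≤ η(1 + H)`, `η < 1/(4T)`, (R3) `|φ_δ| ≤ C|δ|(1 + H)^k`, (R4) `φ_δ/δ → h₀` pointwise —
implies the quadratic-mean first-order control (S1d) of the odd log-density: for every `L²`
linear-response density `h` of the family at `δ = 0` and every `D > ∫ (h − h∘Θ)² dμ_{N,T,T}`,
eventually in `δ ≠ 0` the state `μ_δ` has an everywhere positive measurable Lebesgue density `ρ_δ`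
with `∫ (log ρ_δ − log ρ_δ∘Θ)² dμ_δ ≤ D δ²` (`Θ(q, p) = (q, −p)`).

Proof. `ρ_δ := e^{φ_δ} e^{−H/T}/Z` is a positive Lebesgue density of `μ_δ` with
`log ρ_δ − log ρ_δ∘Θ = φ_δ − φ_δ∘Θ =: d_δ` (`H` is even in the momenta), and
`∫ d_δ² dμ_δ = δ² ∫ (d_δ/δ)² e^{φ_δ} dμ_T`. By dominated convergence (bound
`4C²(1 + H)^{2k} e^{η(1+H)} ∈ L¹(μ_T)`, `pinnedChain_integrable_exp_mul_hamiltonian_gibbsMeasure`)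
`∫ (d_δ/δ)² e^{φ_δ} dμ_T → ∫ (h₀ − h₀∘Θ)² dμ_T`. Differentiating `∫ F e^{φ_δ} dμ_T` under the integral
sign (same domination) shows that `h₀ ∈ L¹(μ_T)` is a weak `δ`-derivative of the family tested on
`C_c^∞`, as is the given `h`; weak derivatives being unique a.e.
(`ae_eq_of_integral_contDiff_smul_eq`), `h = h₀` `μ_T`-a.e., so `∫ (h₀ − h₀∘Θ)² dμ_T =
∫ (h − h∘Θ)² dμ_{N,T,T} < D` (flip-invariance of `μ_T`), and the bound holds eventually.
(The bond-current clause of the response-density interface is not needed.) The two dominated-convergence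
lemmas live in the helper file `…OddLogDensityOfRegularityAux1`; the a.e. uniqueness of weak derivatives,
the density bookkeeping `μ_T · e^{ψ} = ρ · Lebesgue` and `∫ d² d(μ · e^ψ) = δ² ∫ (d/δ)² e^ψ dμ` are below.

References: J. A. McLennan, Phys. Rev. 115 (1959) 1405; C. Maes, K. Netočný, J. Math. Phys. 51 (2010)
015219, Thm 3.1 (the McLennan/linear-response log-density `h₀`).
-/

noncomputable section

namespace Summit.AtomisticToContinuum.FouriersLaw.Theorems.ExtensiveSnapshotIrreversibility.ClausiusBudget

open MeasureTheory Filter Topology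
open scoped ENNReal NNReal
open Literature.MathematicalPhysics.KineticTheory.HeatConduction
open Summit.AtomisticToContinuum.FouriersLaw.Theorems.ExtensiveSnapshotIrreversibility.Negative
open Summit.AtomisticToContinuum.FouriersLaw.Theorems.ExtensiveSnapshotIrreversibility.ClausiusBudget.OddLogDensity

namespace OddLogDensity

open Real

/-! ## Weak derivatives are unique a.e.; positive densities as Gibbs reweightings -/

variable {N : ℕ}

/-- Two `L¹(μ)` functions on phase space that are limits of the SAME difference quotients tested
against every `C_c^∞` function coincide `μ`-a.e. (limits in the punctured filter are unique, and
`C_c^∞` separates `L¹_loc`; Mathlib's `ae_eq_of_integral_contDiff_smul_eq`). [folklore] -/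
theorem ae_eq_of_tendsto_testFunction {μ : Measure (PhaseSpace N)} {h h₀ : PhaseSpace N → ℝ}
    (hh : Integrable h μ) (hh₀ : Integrable h₀ μ) {Q : (PhaseSpace N → ℝ) → ℝ → ℝ}
    (h1 : ∀ F : PhaseSpace N → ℝ, ContDiff ℝ ((⊤ : ℕ∞) : WithTop ℕ∞) F → HasCompactSupport F →
      Tendsto (Q F) (𝓝[≠] (0 : ℝ)) (𝓝 (∫ x, F x * h x ∂μ)))
    (h2 : ∀ F : PhaseSpace N → ℝ, ContDiff ℝ ((⊤ : ℕ∞) : WithTop ℕ∞) F → HasCompactSupport F →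
      Tendsto (Q F) (𝓝[≠] (0 : ℝ)) (𝓝 (∫ x, F x * h₀ x ∂μ))) :
    h =ᵐ[μ] h₀ :=
  ae_eq_of_integral_contDiff_smul_eq hh.locallyIntegrable hh₀.locallyIntegrable fun F hF hFc => by
    simpa only [smul_eq_mul] using tendsto_nhds_unique (h1 F hF hFc) (h2 F hF hFc)

/-- **The Gibbs state reweighted by `e^ψ` has the positive Lebesgue density
`ρ = e^ψ e^{-H/T}/Z`, whose odd log-part is `ψ − ψ∘Θ`** (`H(q, −p) = H(q, p)`). [folklore] -/
theorem exists_density_of_gibbs_withDensity_exp (P : OscillatorChain) (N : ℕ) (T : ℝ)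
    (hZ : Integrable (P.gibbsDensity N T)) (hcont : Continuous (P.gibbsDensity N T))
    {ψ : PhaseSpace N → ℝ} (hψ : Measurable ψ) :
    ∃ ρ : PhaseSpace N → ℝ, Measurable ρ ∧ (∀ x, 0 < ρ x) ∧
      (volume : Measure (PhaseSpace N)).withDensity (fun x => ENNReal.ofReal (ρ x)) =
        (P.gibbsMeasure N T).withDensity (fun x => ENNReal.ofReal (exp (ψ x))) ∧
      ∀ x : PhaseSpace N, Real.log (ρ x) - Real.log (ρ (x.1, -x.2)) = ψ x - ψ (x.1, -x.2) := by
  set Z : ℝ := ∫ x, P.gibbsDensity N T x with hZdef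
  have hZpos : 0 < Z := integral_exp_pos hZ
  have hgpos : ∀ x, 0 < P.gibbsDensity N T x / Z := fun x => div_pos (P.gibbsDensity_pos N T x) hZpos
  have hgΘ : ∀ x : PhaseSpace N, P.gibbsDensity N T (x.1, -x.2) = P.gibbsDensity N T x := fun x => by
    simp only [OscillatorChain.gibbsDensity, OscillatorChain.hamiltonian_neg_momentum]
  have hgm : Measurable fun x => P.gibbsDensity N T x / Z := hcont.measurable.div_const Z
  refine ⟨fun x => P.gibbsDensity N T x / Z * exp (ψ x), hgm.mul hψ.exp,
    fun x => mul_pos (hgpos x) (exp_pos _), ?_, fun x => ?_⟩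
  · have hsplit : (fun x => ENNReal.ofReal (P.gibbsDensity N T x / Z * exp (ψ x))) =
        (fun x => ENNReal.ofReal (P.gibbsDensity N T x / Z)) * fun x => ENNReal.ofReal (exp (ψ x)) := by
      funext x
      simp only [Pi.mul_apply]
      exact ENNReal.ofReal_mul (hgpos x).le
    rw [hsplit, withDensity_mul _ hgm.ennreal_ofReal hψ.exp.ennreal_ofReal]
    rfl
  · show Real.log (P.gibbsDensity N T x / Z * exp (ψ x)) -
        Real.log (P.gibbsDensity N T (x.1, -x.2) / Z * exp (ψ (x.1, -x.2))) = ψ x - ψ (x.1, -x.2)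
    rw [hgΘ, Real.log_mul (hgpos x).ne' (exp_pos _).ne', Real.log_mul (hgpos x).ne' (exp_pos _).ne',
      Real.log_exp, Real.log_exp]
    ring

/-- Integrability and value of `∫ d² d(μ · e^ψ)` in terms of `∫ (d/δ)² e^ψ dμ` (`δ ≠ 0`). [folklore] -/
theorem integral_sq_withDensity_exp (μ : Measure (PhaseSpace N)) {ψ : PhaseSpace N → ℝ}
    (hψ : Measurable ψ) (d : PhaseSpace N → ℝ) {δ : ℝ} (hδ : δ ≠ 0)
    (hG : Integrable (fun x => (d x / δ) ^ 2 * exp (ψ x)) μ) :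
    Integrable (fun x => d x ^ 2) (μ.withDensity fun x => ENNReal.ofReal (exp (ψ x))) ∧
      ∫ x, d x ^ 2 ∂(μ.withDensity fun x => ENNReal.ofReal (exp (ψ x))) =
        δ ^ 2 * ∫ x, (d x / δ) ^ 2 * exp (ψ x) ∂μ := by
  have hflt : ∀ᵐ x ∂μ, ENNReal.ofReal (exp (ψ x)) < ∞ :=
    Eventually.of_forall fun _ => ENNReal.ofReal_lt_top
  have hm : Measurable fun x => ENNReal.ofReal (exp (ψ x)) := hψ.exp.ennreal_ofReal
  have hpt : ∀ x, (ENNReal.ofReal (exp (ψ x))).toReal • d x ^ 2 = δ ^ 2 * ((d x / δ) ^ 2 * exp (ψ x)) :=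
    fun x => by
      rw [ENNReal.toReal_ofReal (exp_pos _).le, smul_eq_mul]
      field_simp
  constructor
  · rw [integrable_withDensity_iff_integrable_smul' hm hflt]
    simp_rw [hpt]
    exact hG.const_mul _
  · rw [integral_withDensity_eq_integral_toReal_smul hm hflt]
    simp_rw [hpt]
    exact integral_const_mul _ _

end OddLogDensity

/-! ## The stub -/

/-- **S1g `stub_oddLogDensity_of_regularity`** (crux `ExtensiveSnapshotIrreversibility`, line
`clausius-budget-sound-window`; fixed `N ≥ 2`). The regularity statement (R) of the NESS log-density
(for the family `μ`, `T > 0`, `N ≥ 2`: `δ₀ > 0`, `0 < η < 1/(4T)`, `C`, `k`, measurable `φ_δ`, `h₀` with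
`μ_{N,T+δ/2,T−δ/2} = μ_T · e^{φ_δ}` for `0 < |δ| < δ₀`, `|φ_δ| ≤ η(1 + H)`, `|φ_δ| ≤ C|δ|(1 + H)^k`,
`φ_δ/δ → h₀` pointwise) IMPLIES S1d verbatim: under weak-NESS uniqueness, along every steady-state
family, for `T > 0`, `N ≥ 2`, every `L²` linear-response density `h` (weak `δ`-derivative at `δ = 0`
tested on `C_c^∞` observables and on the bond currents) and every `D > ∫ (h − h∘Θ)² dμ_{N,T,T}`:
eventually in `δ ≠ 0` the steady state has an everywhere positive measurable Lebesgue density `ρ_δ`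
with `(log ρ_δ − log ρ_δ∘Θ)² ∈ L¹(μ_δ)` and `∫ (log ρ_δ − log ρ_δ∘Θ)² dμ_δ ≤ D δ²`.
Proof: `ρ_δ = e^{φ_δ} e^{−H/T}/Z`, `log ρ_δ − log ρ_δ∘Θ = φ_δ − φ_δ∘Θ`; dominated convergence
`δ⁻² ∫ (φ_δ − φ_δ∘Θ)² e^{φ_δ} dμ_T → ∫ (h₀ − h₀∘Θ)² dμ_T`; `h₀` is itself a weak derivative tested
on `C_c^∞` (differentiation under the integral sign), hence `h = h₀` `μ_T`-a.e. and the limit is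
`∫ (h − h∘Θ)² dμ_{N,T,T} < D` (`μ_{N,T,T} = μ_T` by uniqueness + `pinnedChain_isSteadyState_gibbsMeasure`).
(McLennan 1959; Maes–Netočný 2010, Thm 3.1, for the linear-response log-density `h₀`.) [folklore] -/
theorem stub_oddLogDensity_of_regularity :
    (∀ ω₂ lam β γ : ℝ, 0 < ω₂ → 0 < lam → 0 < β → 0 < γ →
      (∀ (N : ℕ) (T_L T_R : ℝ), 0 < T_L → 0 < T_R → ∀ μ ν : Measure (PhaseSpace N),
        (pinnedChain ω₂ lam β γ).IsSteadyState N T_L T_R μ →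
        (pinnedChain ω₂ lam β γ).IsSteadyState N T_L T_R ν → μ = ν) →
      ∀ μ : (N : ℕ) → ℝ → ℝ → Measure (PhaseSpace N),
        (∀ (N : ℕ) (T_L T_R : ℝ), 0 < T_L → 0 < T_R →
          (pinnedChain ω₂ lam β γ).IsSteadyState N T_L T_R (μ N T_L T_R)) →
        ∀ T : ℝ, 0 < T → ∀ N : ℕ, 2 ≤ N →
          ∃ δ₀ η C : ℝ, ∃ k : ℕ, 0 < δ₀ ∧ 0 < η ∧ η < 1 / (4 * T) ∧
          ∃ φ : ℝ → PhaseSpace N → ℝ, ∃ h₀ : PhaseSpace N → ℝ,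
            (∀ δ : ℝ, Measurable (φ δ)) ∧ Measurable h₀ ∧
            (∀ δ : ℝ, δ ≠ 0 → |δ| < δ₀ →
              μ N (T + δ / 2) (T - δ / 2) =
                ((pinnedChain ω₂ lam β γ).gibbsMeasure N T).withDensity
                  (fun x => ENNReal.ofReal (Real.exp (φ δ x)))) ∧
            (∀ δ : ℝ, |δ| < δ₀ → ∀ x : PhaseSpace N,
              |φ δ x| ≤ η * (1 + (pinnedChain ω₂ lam β γ).hamiltonian N x)) ∧
            (∀ δ : ℝ, |δ| < δ₀ → ∀ x : PhaseSpace N,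
              |φ δ x| ≤ C * |δ| * (1 + (pinnedChain ω₂ lam β γ).hamiltonian N x) ^ k) ∧
            (∀ x : PhaseSpace N, Tendsto (fun δ : ℝ => φ δ x / δ) (𝓝[≠] (0 : ℝ)) (𝓝 (h₀ x)))) →
    ∀ ω₂ lam β γ : ℝ, 0 < ω₂ → 0 < lam → 0 < β → 0 < γ →
      (∀ (N : ℕ) (T_L T_R : ℝ), 0 < T_L → 0 < T_R → ∀ μ ν : Measure (PhaseSpace N),
        (pinnedChain ω₂ lam β γ).IsSteadyState N T_L T_R μ →
        (pinnedChain ω₂ lam β γ).IsSteadyState N T_L T_R ν → μ = ν) →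
      ∀ μ : (N : ℕ) → ℝ → ℝ → Measure (PhaseSpace N),
        (∀ (N : ℕ) (T_L T_R : ℝ), 0 < T_L → 0 < T_R →
          (pinnedChain ω₂ lam β γ).IsSteadyState N T_L T_R (μ N T_L T_R)) →
        ∀ T : ℝ, 0 < T → ∀ N : ℕ, 2 ≤ N → ∀ h : PhaseSpace N → ℝ,
          (MemLp h 2 (μ N T T) ∧
            (∀ F : PhaseSpace N → ℝ, ContDiff ℝ ((⊤ : ℕ∞) : WithTop ℕ∞) F → HasCompactSupport F →
              Tendsto (fun δ : ℝ => ((∫ x, F x ∂(μ N (T + δ / 2) (T - δ / 2))) - ∫ x, F x ∂(μ N T T)) / δ)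
                (𝓝[≠] (0 : ℝ)) (𝓝 (∫ x, F x * h x ∂(μ N T T)))) ∧
            (∀ i : Fin N, Tendsto (fun δ : ℝ =>
                ((∫ x, (pinnedChain ω₂ lam β γ).bondCurrent N i x ∂(μ N (T + δ / 2) (T - δ / 2))) -
                  ∫ x, (pinnedChain ω₂ lam β γ).bondCurrent N i x ∂(μ N T T)) / δ)
                (𝓝[≠] (0 : ℝ)) (𝓝 (∫ x, (pinnedChain ω₂ lam β γ).bondCurrent N i x * h x ∂(μ N T T))))) →
          ∀ D : ℝ, ∫ x, (h x - h (x.1, -x.2)) ^ 2 ∂(μ N T T) < D →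
            ∀ᶠ δ in 𝓝[≠] (0 : ℝ), ∃ ρ : PhaseSpace N → ℝ, Measurable ρ ∧ (∀ x, 0 < ρ x) ∧
              μ N (T + δ / 2) (T - δ / 2) =
                (volume : Measure (PhaseSpace N)).withDensity (fun x => ENNReal.ofReal (ρ x)) ∧
              Integrable (fun x => (Real.log (ρ x) - Real.log (ρ (x.1, -x.2))) ^ 2)
                (μ N (T + δ / 2) (T - δ / 2)) ∧
              ∫ x, (Real.log (ρ x) - Real.log (ρ (x.1, -x.2))) ^ 2 ∂(μ N (T + δ / 2) (T - δ / 2))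
                ≤ D * δ ^ 2 := by
  intro hR ω₂ lam β γ hω hl hβ hγ hU μ hμ T hT N hN h hh D hD
  obtain ⟨δ₀, η, C, k, hδ₀, hη, hη4, φ, h₀, hφm, hh₀m, hR1, hR2, hR3, hR4⟩ :=
    hR ω₂ lam β γ hω hl hβ hγ hU μ hμ T hT N hN
  set P := pinnedChain ω₂ lam β γ with hP
  set μT := P.gibbsMeasure N T with hμT
  haveI : IsProbabilityMeasure μT := pinnedChain_isProbabilityMeasure_gibbsMeasure hω hl.le hβ.le γ N hT
  -- (0) `μ N T T = μ_T`; `η < 1/T`; `0 ≤ C`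
  have hG : μ N T T = μT :=
    hU N T T hT hT _ _ (hμ N T T hT hT) (pinnedChain_isSteadyState_gibbsMeasure hω hl.le hβ.le γ N hT)
  have hηT : η < 1 / T :=
    hη4.trans_le (one_div_le_one_div_of_le hT (by linarith))
  have hC : 0 ≤ C := by
    have hx := hR3 (δ₀ / 2) (by rw [abs_of_pos (by positivity)]; linarith) (0 : PhaseSpace N)
    have h0 := (abs_nonneg _).trans hx
    have hpos : 0 < |δ₀ / 2| * (1 + P.hamiltonian N 0) ^ k := by
      have := pinnedChain_hamiltonian_nonneg hω.le hl.le hβ.le γ N (0 : PhaseSpace N)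
      positivity
    rcases le_or_gt 0 C with hC | hC
    · exact hC
    · nlinarith [mul_neg_of_neg_of_pos hC hpos]
  -- (1) `h₀ ∈ L¹(μ_T)`, `h ∈ L¹(μ_T)`, and `h = h₀` a.e. (both are weak derivatives tested on `C_c^∞`)
  have hh₀i : Integrable h₀ μT :=
    integrable_of_abs_le_mul_one_add_pow hω hl.le hβ.le γ N hT hh₀m.aestronglyMeasurable
      (fun x => abs_le_of_tendsto_div hδ₀ (hR4 x) (fun δ hδ => hR3 δ hδ x))
  have hhi : Integrable h μT := by
    have := hh.1
    rw [hG] at this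
    exact this.integrable one_le_two
  have hclause₀ : ∀ F : PhaseSpace N → ℝ, ContDiff ℝ ((⊤ : ℕ∞) : WithTop ℕ∞) F → HasCompactSupport F →
      Tendsto (fun δ : ℝ => ((∫ x, F x ∂(μ N (T + δ / 2) (T - δ / 2))) - ∫ x, F x ∂μT) / δ)
        (𝓝[≠] (0 : ℝ)) (𝓝 (∫ x, F x * h₀ x ∂μT)) := by
    intro F hF hFc
    exact tendsto_diffQuot_integral_of_regularity hω hl.le hβ.le γ N hT hδ₀ hηT hφm hR2 hR3 hC hR4
      (ν := fun δ => μ N (T + δ / 2) (T - δ / 2)) hR1 hF.continuous hFc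
  have hclause : ∀ F : PhaseSpace N → ℝ, ContDiff ℝ ((⊤ : ℕ∞) : WithTop ℕ∞) F → HasCompactSupport F →
      Tendsto (fun δ : ℝ => ((∫ x, F x ∂(μ N (T + δ / 2) (T - δ / 2))) - ∫ x, F x ∂μT) / δ)
        (𝓝[≠] (0 : ℝ)) (𝓝 (∫ x, F x * h x ∂μT)) := by
    intro F hF hFc
    have := hh.2.1 F hF hFc
    rwa [hG] at this
  have hae : h =ᵐ[μT] h₀ := ae_eq_of_tendsto_testFunction hhi hh₀i hclause hclause₀
  -- (2) the constant: `∫ (h − h∘Θ)² dμ_{N,T,T} = ∫ (h₀ − h₀∘Θ)² dμ_T < D`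
  have hL : ∫ x, (h x - h (x.1, -x.2)) ^ 2 ∂μT = ∫ x, (h₀ x - h₀ (x.1, -x.2)) ^ 2 ∂μT := by
    have hmp : MeasurePreserving (momentumReversal N) μT μT :=
      ⟨(momentumReversal N).measurable, gibbsMeasure_map_flip P N T⟩
    have haeΘ : (fun x : PhaseSpace N => h (x.1, -x.2)) =ᵐ[μT] fun x => h₀ (x.1, -x.2) :=
      hmp.quasiMeasurePreserving.ae_eq_comp hae
    exact integral_congr_ae (by filter_upwards [hae, haeΘ] with x h1 h2; rw [h1, h2])
  rw [hG, hL] at hD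
  -- (3) dominated convergence and conclusion
  have hlim := tendsto_integral_flipQuot_sq_mul_exp hω hl.le hβ.le γ N hT hδ₀ hηT hφm hR2 hR3 hR4
  have hZ : Integrable (P.gibbsDensity N T) := pinnedChain_integrable_gibbsDensity hω hl.le hβ.le γ N hT
  have hcont : Continuous (P.gibbsDensity N T) := pinnedChain_continuous_gibbsDensity ω₂ lam β γ N T
  filter_upwards [hlim.eventually_lt_const hD, eventually_ne_and_abs_lt hδ₀] with δ hδD hδ
  obtain ⟨ρ, hρm, hρpos, hρeq, hlog⟩ := exists_density_of_gibbs_withDensity_exp P N T hZ hcont (hφm δ)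
  have hμδ := hR1 δ hδ.1 hδ.2
  obtain ⟨hInt, hval⟩ := integral_sq_withDensity_exp μT (hφm δ) (fun x => φ δ x - φ δ (x.1, -x.2)) hδ.1
    (integrable_flipQuot_sq_mul_exp hω hl.le hβ.le γ N hT hηT hφm hR2 hR3 hδ.1 hδ.2)
  refine ⟨ρ, hρm, hρpos, by rw [hμδ, hρeq], ?_, ?_⟩
  · rw [hμδ]
    simp_rw [hlog]
    exact hInt
  · rw [hμδ]
    simp_rw [hlog]
    rw [hval]
    nlinarith [hδD, sq_nonneg δ]

end Summit.AtomisticToContinuum.FouriersLaw.Theorems.ExtensiveSnapshotIrreversibility.ClausiusBudget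

end
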